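import Literature.Analysis.FluidPDE.TypeIAncientMildClassical
import Literature.Analysis.FluidPDE.PineauVicolRSSAlphaZero
import Literature.Analysis.FluidPDE.TsaiSelfSimilarBounded
import HarnessLib

/-!
# Route SymmetryModuliCount — the self-similar leaf of `SymmetricLiouville` (Tsai 1998, `q = ∞`)

Theorems file serving the crux item stmt-NavierStokesRegularity-4053
(`Summit.NavierStokesRegularity.NavierStokesRegularity.Theses.SymmetryModuliCount.SymmetricLiouville`),
line `blowdown-kills-pitch`, registered stub `stub_selfSimilarLeaf` (the `A = 0` half of the
spiral-scaling leaf):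

* if a Type-I KNSS-mild ancient field `u ∈ A_C` on `ℝ³` (`IsTypeIAncientMild C u`: jointly smooth
  on `t < 0`, divergence free, Oseen-mild between all pairs of negative times, `‖u‖ ≤ C/√(−t)`) is
  annihilated on `t < 0` by the scaling generator `ξ = (0, 1, 0)`,
  `D(u t)(x) x + u t x + 2t ∂ₜu(t, x) = 0`, then `u ≡ 0` on `t < 0`.

## Proof

1. *Integrate the clause.* For `t < 0`, `x` fixed, the scaling orbit
   `g(λ) = λ u(λ²t, λx)`, `λ > 0`, has `g'(λ) = u + 2T∂ₜu + Du[X]` at `(T, X) = (λ²t, λx)`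
   (chain rule through the jointly smooth `uncurry u` on the open slab), which is the clause, so
   `g` is constant on the connected open set `(0, ∞)` (`IsOpen.is_const_of_deriv_eq_zero`);
   `λ = (−t)^{-1/2}` gives `u(t, x) = (−t)^{-1/2} U(x/√(−t))`, `U = u(−1, ·)`: `u` is Leray
   backward self-similar, `u = lerayBackward ½ 0 U = pvAnsatz 0 U` on `t < 0`.
2. *Tsai in the gauge* (verbatim the route of `pineauVicol2026_rss_liouville_alpha_zero`): the
   KNSS pressure makes `u` classical on `(−2, 0)`
   (`IsTypeIAncientMild.exists_isClassicalNSSolutionOn_Ioo`), hence on `[−1, 0)`; the ansatz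
   field extends classically to `(−∞, 0)` with one pressure
   (`exists_isClassicalNSSolutionOn_Iio_of_rss`), whose normalisation is self-similar
   (`normalisedPressure_selfSimilar`), i.e. `lerayBackwardPressure ½ 0 Q`, `Q = P(−1,·) − P(−1,0)`;
   Leray's reduction (`lerayBackward_isClassical_iff_holds`) makes `(U, Q)` a profile
   (`IsLerayProfile 1 ½ U Q`), `U` is bounded by `C` (the Type-I bound at `t = −1`), and Tsai 1998,
   Theorem 1 with `q = ∞` (`tsai_selfsimilar_bounded_holds`) makes `U ≡ c` constant.
3. *The gauge kills the constant.* Then `u(t, ·) = (−t)^{-1/2} c` is slice-wise constant, and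
   `IsTypeIAncientMild.eq_zero_of_slice_const` (KNSS 2009, Remark 6.1 + the Type-I rate) gives
   `u ≡ 0`.

No new definitions, no named facts; trust base Mathlib's axioms (through
`tsai_selfsimilar_bounded_holds`, `lerayBackward_isClassical_iff_holds`,
`classical_of_smooth_isMildNSSolutionOn_holds`).

## References

* T.-P. Tsai, Arch. Rational Mech. Anal. 143 (1998) 29–51, Theorem 1 (`q = ∞`). [Tsai1998]
* G. Koch, N. Nadirashvili, G. Seregin, V. Šverák, Acta Math. 203 (2009) 83–105, Remark 6.1.
  [KochNadirashviliSereginSverak2009]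
* B. Pineau, V. Vicol, arXiv:2607.09619 (2026), §1.2 (the case `α = 0`). [PineauVicol2026]
-/

noncomputable section

-- the summit and its single sub-problem share the name (CONVENTIONS §1), as in every Theorems file
set_option linter.dupNamespace false

open Set Function Filter
open scoped Topology ContDiff
open Literature.Analysis.FluidPDE

namespace Summit.NavierStokesRegularity.NavierStokesRegularity.Theorems.SymmetryModuliCountSymmetricLiouville

/-- Local notation for physical space `ℝ³`. -/
local notation "E3" => EuclideanSpace ℝ (Fin 3)

namespace SelfSimilarLeaf

/-! ## Calculus on the open slab `(-∞, 0) × ℝ³` -/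

/-- A field jointly smooth on the open slab `(-∞, 0) × ℝ³` has a Fréchet derivative (its `fderiv`)
at every point `(t, x)` with `t < 0`. [folklore] -/
theorem hasFDerivAt_uncurry_of_slab {u : ℝ → E3 → E3}
    (h : ContDiffOn ℝ (⊤ : ℕ∞) (uncurry u) (Iio 0 ×ˢ univ)) {t : ℝ} (ht : t < 0) (x : E3) :
    HasFDerivAt (uncurry u) (fderiv ℝ (uncurry u) (t, x)) (t, x) := by
  have hO : IsOpen (Iio (0 : ℝ) ×ˢ (univ : Set E3)) := isOpen_Iio.prod isOpen_univ
  have hmem : ((t, x) : ℝ × E3) ∈ Iio (0 : ℝ) ×ˢ (univ : Set E3) := mk_mem_prod ht (mem_univ _)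
  exact ((h.contDiffAt (hO.mem_nhds hmem)).differentiableAt (by simp)).hasFDerivAt

/-- On the open slab the time derivative is the partial derivative `D(uncurry u)(t, x)(1, 0)`
(chain rule along `s ↦ (s, x)`). [folklore] -/
theorem timeDeriv_eq_fderiv_uncurry_of_slab {u : ℝ → E3 → E3}
    (h : ContDiffOn ℝ (⊤ : ℕ∞) (uncurry u) (Iio 0 ×ˢ univ)) {t : ℝ} (ht : t < 0) (x : E3) :
    timeDeriv u t x = fderiv ℝ (uncurry u) (t, x) ((1 : ℝ), (0 : E3)) := by
  have h1 : HasDerivAt (fun s : ℝ => ((s, x) : ℝ × E3)) ((1 : ℝ), (0 : E3)) t :=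
    (hasDerivAt_id' t).prodMk (hasDerivAt_const t x)
  have h2 := (hasFDerivAt_uncurry_of_slab h ht x).comp_hasDerivAt t h1
  rw [timeDeriv_apply]
  exact h2.deriv

/-- On the open slab the slice derivative is the partial derivative `D(uncurry u)(t, x)(0, v)`
(chain rule along `y ↦ (t, y)`). [folklore] -/
theorem fderiv_slice_eq_fderiv_uncurry_of_slab {u : ℝ → E3 → E3}
    (h : ContDiffOn ℝ (⊤ : ℕ∞) (uncurry u) (Iio 0 ×ˢ univ)) {t : ℝ} (ht : t < 0) (x v : E3) :
    fderiv ℝ (u t) x v = fderiv ℝ (uncurry u) (t, x) ((0 : ℝ), v) := by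
  have h1 : HasFDerivAt (fun y : E3 => ((t, y) : ℝ × E3)) (ContinuousLinearMap.inr ℝ ℝ E3) x :=
    hasFDerivAt_prodMk_right t x
  have h2 : HasFDerivAt (u t)
      ((fderiv ℝ (uncurry u) (t, x)).comp (ContinuousLinearMap.inr ℝ ℝ E3)) x :=
    (hasFDerivAt_uncurry_of_slab h ht x).comp x h1
  rw [h2.fderiv]
  rfl

/-- **Derivative along the scaling orbit.** For `t < 0`, `x ∈ ℝ³` and `λ > 0`, the orbit
`m ↦ m • u (m² t) (m • x)` of the scaling `ξ = (0, 1, 0)` has derivative at `λ` equal to the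
generator clause `D(u T)(X) X + u T X + 2T ∂ₜu(T, X)` evaluated at `(T, X) = (λ² t, λ x)`.
[folklore] -/
theorem hasDerivAt_scalingOrbit {u : ℝ → E3 → E3}
    (h : ContDiffOn ℝ (⊤ : ℕ∞) (uncurry u) (Iio 0 ×ˢ univ)) {t : ℝ} (ht : t < 0) (x : E3)
    {l : ℝ} (hl : 0 < l) :
    HasDerivAt (fun m : ℝ => m • u (m ^ 2 * t) (m • x))
      (fderiv ℝ (u (l ^ 2 * t)) (l • x) (l • x) + u (l ^ 2 * t) (l • x)
        + (2 * (l ^ 2 * t)) • timeDeriv u (l ^ 2 * t) (l • x)) l := by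
  have hT : l ^ 2 * t < 0 := mul_neg_of_pos_of_neg (pow_pos hl 2) ht
  have hd := hasFDerivAt_uncurry_of_slab h hT (l • x)
  -- the curve `m ↦ (m² t, m x)`
  have hc1 : HasDerivAt (fun m : ℝ => m ^ 2 * t) (2 * l * t) l := by
    have := (hasDerivAt_pow 2 l).mul_const t
    simpa [pow_one] using this
  have hc2 : HasDerivAt (fun m : ℝ => m • x) x l := by
    simpa using (hasDerivAt_id' l).smul_const x
  have hc : HasDerivAt (fun m : ℝ => ((m ^ 2 * t, m • x) : ℝ × E3)) ((2 * l * t, x) : ℝ × E3) l :=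
    hc1.prodMk hc2
  have hcomp : HasDerivAt (uncurry u ∘ fun m : ℝ => ((m ^ 2 * t, m • x) : ℝ × E3))
      (fderiv ℝ (uncurry u) (l ^ 2 * t, l • x) ((2 * l * t, x) : ℝ × E3)) l :=
    hd.comp_hasDerivAt l hc
  have hg : HasDerivAt (fun m : ℝ => m • u (m ^ 2 * t) (m • x))
      (l • fderiv ℝ (uncurry u) (l ^ 2 * t, l • x) ((2 * l * t, x) : ℝ × E3)
        + (1 : ℝ) • u (l ^ 2 * t) (l • x)) l :=
    (hasDerivAt_id' l).smul hcomp
  refine hg.congr_deriv ?_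
  have hsplit : ((2 * l * t, x) : ℝ × E3) = (2 * l * t) • ((1 : ℝ), (0 : E3)) + ((0 : ℝ), x) := by
    ext <;> simp
  rw [hsplit, map_add, map_smul, ← timeDeriv_eq_fderiv_uncurry_of_slab h hT,
    ← fderiv_slice_eq_fderiv_uncurry_of_slab h hT, one_smul, smul_add, smul_smul,
    ← (fderiv ℝ (u (l ^ 2 * t)) (l • x)).map_smul]
  have e : l * (2 * l * t) = 2 * (l ^ 2 * t) := by ring
  rw [e]
  abel

/-- **Integrating the clause.** If `uncurry u` is smooth on the open slab and `u` is annihilated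
by the scaling generator, `D(u t)(x) x + u t x + 2t ∂ₜu = 0` for `t < 0`, then `u` is invariant
under every Leray rescaling: `λ u(λ² t, λ x) = u(t, x)` for `λ > 0`, `t < 0` (the orbit has zero
derivative on the connected open set `(0, ∞)`). [folklore] -/
theorem smul_apply_sq_mul_eq_of_generator {u : ℝ → E3 → E3}
    (h : ContDiffOn ℝ (⊤ : ℕ∞) (uncurry u) (Iio 0 ×ˢ univ))
    (hL : ∀ t < 0, ∀ x, fderiv ℝ (u t) x x + u t x + (2 * t) • timeDeriv u t x = 0)
    {t : ℝ} (ht : t < 0) (x : E3) {l : ℝ} (hl : 0 < l) :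
    l • u (l ^ 2 * t) (l • x) = u t x := by
  have hder : ∀ m ∈ Ioi (0 : ℝ), HasDerivAt (fun m : ℝ => m • u (m ^ 2 * t) (m • x)) 0 m := by
    intro m hm
    have hm : 0 < m := hm
    have key := hasDerivAt_scalingOrbit h ht x hm
    rw [hL _ (mul_neg_of_pos_of_neg (pow_pos hm 2) ht)] at key
    exact key
  have hdiff : DifferentiableOn ℝ (fun m : ℝ => m • u (m ^ 2 * t) (m • x)) (Ioi 0) :=
    fun m hm => (hder m hm).differentiableAt.differentiableWithinAt
  have hd0 : (Ioi (0 : ℝ)).EqOn (deriv fun m : ℝ => m • u (m ^ 2 * t) (m • x)) 0 :=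
    fun m hm => (hder m hm).deriv
  have key := isOpen_Ioi.is_const_of_deriv_eq_zero isPreconnected_Ioi hdiff hd0 hl
    (zero_lt_one : (0 : ℝ) < 1)
  simpa using key

/-- **The clause makes `u` Leray backward self-similar about the space–time origin**:
`u(t, x) = (−t)^{-1/2} u(−1, x/√(−t))` for `t < 0` (`λ = (−t)^{-1/2}` in
`smul_apply_sq_mul_eq_of_generator`). [folklore] -/
theorem eq_sqrt_inv_smul_of_generator {u : ℝ → E3 → E3}
    (h : ContDiffOn ℝ (⊤ : ℕ∞) (uncurry u) (Iio 0 ×ˢ univ))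
    (hL : ∀ t < 0, ∀ x, fderiv ℝ (u t) x x + u t x + (2 * t) • timeDeriv u t x = 0)
    {t : ℝ} (ht : t < 0) (x : E3) :
    u t x = (Real.sqrt (-t))⁻¹ • u (-1) ((Real.sqrt (-t))⁻¹ • x) := by
  have hnt : 0 < -t := neg_pos.2 ht
  have hl : 0 < (Real.sqrt (-t))⁻¹ := inv_pos.2 (Real.sqrt_pos.2 hnt)
  have key := smul_apply_sq_mul_eq_of_generator h hL ht x hl
  have hct : ((Real.sqrt (-t))⁻¹) ^ 2 * t = -1 := by
    rw [inv_pow, Real.sq_sqrt hnt.le, inv_mul_eq_div, div_neg, div_self ht.ne]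
  rw [hct] at key
  exact key.symm

/-! ## Pressure bookkeeping (copies of the private helpers of `PineauVicolRSSAlphaZero`) -/

/-- Normalising the pressure (`p ↦ p − p(·, 0)`) preserves classical solutions. [folklore] -/
theorem isClassicalNSSolutionOn_normalise_pressure {S : Set ℝ} {ν : ℝ} {f v : ℝ → E3 → E3}
    {p : ℝ → E3 → ℝ} (h : IsClassicalNSSolutionOn S ν f v p) :
    IsClassicalNSSolutionOn S ν f v (fun t x => p t x - p t 0) where
  smooth_velocity := h.smooth_velocity
  smooth_pressure := h.smooth_pressure.sub_apply_zero
  momentum t ht x := by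
    rw [gradient_sub_const]
    exact h.momentum t ht x
  divFree := h.divFree

/-- Replacing the pressure by a field with the same slices on `S` preserves classical
solutions. [folklore] -/
theorem isClassicalNSSolutionOn_congr_pressure' {S : Set ℝ} {ν : ℝ} {f v : ℝ → E3 → E3}
    {p p' : ℝ → E3 → ℝ} (h : IsClassicalNSSolutionOn S ν f v p) (hp : ∀ t ∈ S, p' t = p t) :
    IsClassicalNSSolutionOn S ν f v p' where
  smooth_velocity := h.smooth_velocity
  smooth_pressure := by
    refine h.smooth_pressure.congr fun z hz => ?_
    obtain ⟨t, x⟩ := z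
    simp only [uncurry_apply_pair, hp t hz.1]
  momentum t ht x := by
    rw [hp t ht]
    exact h.momentum t ht x
  divFree := h.divFree

end SelfSimilarLeaf

/-! ## The registered stub -/

open SelfSimilarLeaf in
/-- **Stub `stub_selfSimilarLeaf` — the self-similar leaf of `SymmetricLiouville` (Tsai 1998,
Theorem 1, `q = ∞`, inside the KNSS gauge).** A Type-I ancient mild field `u ∈ A_C` on `ℝ³`
annihilated by the scaling generator, `D(u t)(x) x + u t x + 2t ∂ₜu(t, x) = 0` on `t < 0`,
vanishes identically: the clause integrates to `u(t, x) = (−t)^{-1/2} U(x/√(−t))` with the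
bounded smooth profile `U = u(−1, ·)`; with the KNSS pressure and Leray's reduction `(U, Q)` is a
Leray profile, Tsai's theorem makes `U` constant, and the gauge (`eq_zero_of_slice_const`) kills
the constant. [folklore] -/
theorem stub_selfSimilarLeaf :
    ∀ (C : ℝ) (u : ℝ → E3 → E3), IsTypeIAncientMild C u →
      (∀ t < 0, ∀ x, fderiv ℝ (u t) x x + u t x + (2 * t) • timeDeriv u t x = 0) →
      ∀ t < 0, ∀ x, u t x = 0 := by
  intro C u hu hL
  -- Step 1: the profile and the self-similar form
  set U : E3 → E3 := u (-1) with hUdef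
  have hss : ∀ t < 0, ∀ x, u t x = (Real.sqrt (-t))⁻¹ • U ((Real.sqrt (-t))⁻¹ • x) :=
    fun t ht x => eq_sqrt_inv_smul_of_generator hu.contDiffOn hL ht x
  have hans : ∀ t ∈ Ico (-1 : ℝ) 0, ∀ x : E3, u t x = pvAnsatz 0 (fun y _ => U y) t x := by
    intro t ht x
    have h2 : (2 : ℝ) * (1 / 2) * (0 - t) = -t := by ring
    rw [pvAnsatz_zero_eq_lerayBackward, lerayBackward_apply, h2]
    exact hss t ht.2 x
  -- Step 2: Tsai in the gauge (the route of `pineauVicol2026_rss_liouville_alpha_zero`)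
  obtain ⟨p, hp⟩ := hu.exists_isClassicalNSSolutionOn_Ioo (t₀ := -2) (by norm_num)
  have hsol : IsClassicalNSSolutionOn (Ico (-1) 0) 1 0 u p :=
    hp.mono (fun t ht => ⟨by linarith [ht.1], ht.2⟩) (uniqueDiffOn_Ico _ _)
  have hφ : ∀ (θ : ℝ) (w : E3), rotZ (θ + 0 * (2 * Real.log 2)) w = rotZ θ w := by
    intro θ w
    rw [zero_mul, add_zero]
  have hdss : IsDiscretelySelfSimilar 2 (pvAnsatz 0 (fun y _ => U y)) :=
    isDiscretelySelfSimilar_pvAnsatz two_pos hφ U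
  obtain ⟨P, hP⟩ := exists_isClassicalNSSolutionOn_Iio_of_rss hsol one_lt_two hdss hans
  rw [pvAnsatz_zero_eq_lerayBackward] at hP
  have hself : ∀ c : ℝ, 0 < c →
      nsRescale c (lerayBackward (1 / 2 : ℝ) 0 U) = lerayBackward (1 / 2) 0 U :=
    fun c hc => isSelfSimilar_lerayBackward_zero (1 / 2) U c hc
  -- the normalised pressure is Leray's `(−t)⁻¹ Q(x/√(−t))` with `Q = P(−1,·) − P(−1,0)`
  set Q : E3 → ℝ := fun y => P (-1) y - P (-1) 0 with hQ
  have hPQ : ∀ t ∈ Iio (0 : ℝ),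
      lerayBackwardPressure (1 / 2) 0 Q t = fun x => P t x - P t 0 := by
    intro t ht
    have ht' : t < 0 := ht
    have hnt : 0 < -t := by linarith
    funext x
    have hc : 0 < (Real.sqrt (-t))⁻¹ := inv_pos.2 (Real.sqrt_pos.2 hnt)
    have key := normalisedPressure_selfSimilar hP hself hc ht' x
    have hsq : ((Real.sqrt (-t))⁻¹) ^ 2 = (-t)⁻¹ := by rw [inv_pow, Real.sq_sqrt hnt.le]
    have hct : ((Real.sqrt (-t))⁻¹) ^ 2 * t = -1 := by
      rw [hsq, inv_mul_eq_div, div_neg, div_self ht'.ne]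
    rw [hct, hsq] at key
    have h2 : (2 : ℝ) * (1 / 2) * (0 - t) = -t := by ring
    simp only [lerayBackwardPressure, h2, hQ]
    exact key
  have hP' : IsClassicalNSSolutionOn (Iio 0) 1 0 (lerayBackward (1 / 2) 0 U)
      (lerayBackwardPressure (1 / 2) 0 Q) :=
    isClassicalNSSolutionOn_congr_pressure' (isClassicalNSSolutionOn_normalise_pressure hP) hPQ
  -- smoothness of `U = u(−1)` and `Q`
  have hUs : ContDiff ℝ ∞ U := hu.contDiff_slice (by norm_num)
  have hQs : ContDiff ℝ ∞ Q :=
    (hP.contDiff_pressure (show (-1 : ℝ) ∈ Iio 0 by norm_num)).sub contDiff_const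
  -- Leray's reduction: `(U, Q)` is a profile with `ν = 1`, `a = ½`
  have hLr := @lerayBackward_isClassical_iff_holds (EuclideanSpace ℝ (Fin 3)) _ _ _
  have hprof : IsLerayProfile 1 (1 / 2) U Q :=
    (hLr (ν := 1) (a := 1 / 2) (T := 0) (by norm_num) hUs hQs).1 hP'
  -- bounded profile (Type I bound at `t = -1`) ⇒ constant (Tsai 1998, Thm 1, `q = ∞`)
  have hbd : ∃ M : ℝ, ∀ y, ‖U y‖ ≤ M := by
    refine ⟨C, fun y => ?_⟩
    have h1 := hu.norm_le (t := -1) (by norm_num) y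
    rw [neg_neg, Real.sqrt_one, div_one] at h1
    exact h1
  obtain ⟨c, hc⟩ :=
    tsai_selfsimilar_bounded_holds (ν := 1) (a := 1 / 2) one_pos (by norm_num) hprof hbd
  -- Step 3: the gauge kills the constant
  intro t ht x
  refine hu.eq_zero_of_slice_const (b := fun s => (Real.sqrt (-s))⁻¹ • c) ?_ ht x
  intro s hs y
  rw [hss s hs y, hc]

end Summit.NavierStokesRegularity.NavierStokesRegularity.Theorems.SymmetryModuliCountSymmetricLiouville

end
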